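import Literature.NumberTheory.Transcendental.KZSemialgebraicComplex
import Literature.NumberTheory.Transcendental.KZPeriodsProofs
import Mathlib.Analysis.SpecialFunctions.Pow.Continuity
import Mathlib.MeasureTheory.Integral.IntervalIntegral.Basic
import Mathlib.Topology.Algebra.Field
import HarnessLib

/-!
# Elliptic integrals along algebraic segments are Kontsevich–Zagier periods

Auxiliary file for the discharge of
`Literature.NumberTheory.Transcendental.isPeriod_of_mem_lattice` (Kontsevich–Zagier 2001, §1.1:
elliptic integrals `∮ dx/y` on `y² = 4x³ − g₂x − g₃`, `g₂, g₃ ∈ ℚ̄`, are periods). We prove: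

* `isPeriod_sum` — finite sums of periods are periods (`IsPeriod.add_holds`);
* `isRealPeriod_integral_re_div_sqrt`, `isPeriod_integral_div_sqrt` — for `x₀, v, g₂, g₃, w` with
  algebraic real and imaginary parts and rationals `a ≤ b` such that
  `p(s) = 4(x₀ + s v)³ − g₂(x₀ + s v) − g₃` stays in the slit plane on `[a, b]`, the number
  `∫ₐᵇ w / √p(s) ds` (principal square root) is a period: its real and imaginary parts are
  absolutely convergent integrals over the `ℚ`-semialgebraic domain `[a, b] ⊆ ℝ¹` of the
  `ℚ`-semialgebraic functions `re/im (w/√p)` (`re_im_ellipticIntegrand`), hence real periods by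
  "rational ⇔ algebraic integrands" (`KZ.isRealPeriod_iff_exists_integralRep_holds`,
  Tarski–Seidenberg);
* `isPeriod_integral_div_of_sq_eq_cubic` — if `y : [0, 1] → ℂˣ` is continuous with
  `y(s)² = p(s)`, then `∫₀¹ v / y(s) ds` is a period: `[0, 1]` is cut at rational points into
  pieces on which `p` or `−p` stays in the slit plane (Lebesgue number), where `y = ±√p`, resp.
  `y = ±i√(−p)` (`IsPreconnected.eq_or_eq_neg_of_sq_eq`), and
  `−p(s) = 4(−x₀ + s(−v))³ − g₂(−x₀ + s(−v)) − (−g₃)` is again of the same shape.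

No new definitions are introduced.

## References

* M. Kontsevich, D. Zagier, *Periods*, in: Mathematics Unlimited — 2001 and Beyond, Springer
  (2001), §1.1.
* A. Huber, S. Müller-Stach, *Periods and Nori Motives*, Springer (2017), §12.2.
-/

noncomputable section

open Set MeasureTheory MvPolynomial Metric
open Literature.ModelTheory.ExponentialFields

namespace Literature.NumberTheory.Transcendental

/-! ### Finite sums of periods -/

/-- Finite sums of periods are periods. [Kontsevich–Zagier 2001, §1.1, p. 5: "periods form an
algebra"] [cite: KontsevichZagier2001, §1.1] -/
theorem isPeriod_sum {ι : Type*} (s : Finset ι) (f : ι → ℂ) (h : ∀ i ∈ s, IsPeriod (f i)) :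
    IsPeriod (∑ i ∈ s, f i) := by
  classical
  induction s using Finset.induction_on with
  | empty => simpa using IsPeriod.zero
  | insert a s ha ih =>
    rw [Finset.sum_insert ha]
    exact IsPeriod.add_holds (h a (Finset.mem_insert_self a s))
      (ih fun i hi => h i (Finset.mem_insert_of_mem hi))

/-! ### Small algebraic facts -/

/-- `√z ≠ 0` for `z ≠ 0`. [folklore] -/
theorem complexSqrt_ne_zero {z : ℂ} (hz : z ≠ 0) : Complex.sqrt z ≠ 0 := by
  rw [Complex.sqrt, Ne, Complex.cpow_eq_zero_iff]
  exact fun h => hz h.1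

/-- `√` is continuous at points of the slit plane. [folklore] -/
theorem continuousAt_complexSqrt {z : ℂ} (hz : z ∈ Complex.slitPlane) :
    ContinuousAt Complex.sqrt z :=
  continuousAt_cpow_const (b := (2⁻¹ : ℂ)) hz

/-- Negation preserves "algebraic real and imaginary parts". [folklore] -/
theorem isAlgebraic_re_im_neg {z : ℂ} (h : IsAlgebraic ℚ z.re ∧ IsAlgebraic ℚ z.im) :
    IsAlgebraic ℚ (-z).re ∧ IsAlgebraic ℚ (-z).im :=
  ⟨by simpa using h.1.neg, by simpa using h.2.neg⟩

/-- Multiplication by `i` preserves "algebraic real and imaginary parts". [folklore] -/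
theorem isAlgebraic_re_im_I_mul {z : ℂ} (h : IsAlgebraic ℚ z.re ∧ IsAlgebraic ℚ z.im) :
    IsAlgebraic ℚ (Complex.I * z).re ∧ IsAlgebraic ℚ (Complex.I * z).im :=
  ⟨by simpa using h.2.neg, by simpa using h.1⟩

/-! ### One algebraic segment in the slit plane -/

/-- The interval `[a, b] ⊆ ℝ¹` with rational endpoints is `ℚ`-semialgebraic.
[cite: KontsevichZagier2001, §1.1] -/
theorem isSemialgebraic_preimage_funUnique_Icc (a b : ℚ) :
    IsSemialgebraic ℚ ((MeasurableEquiv.funUnique (Fin 1) ℝ) ⁻¹' Icc (a : ℝ) b) := by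
  have hset : (MeasurableEquiv.funUnique (Fin 1) ℝ) ⁻¹' Icc (a : ℝ) b =
      {x : Fin 1 → ℝ | aeval x (C a : MvPolynomial (Fin 1) ℚ) ≤ aeval x (X 0 : MvPolynomial (Fin 1) ℚ)} ∩
        {x | aeval x (X 0 : MvPolynomial (Fin 1) ℚ) ≤ aeval x (C b : MvPolynomial (Fin 1) ℚ)} := by
    ext y
    simp [MeasurableEquiv.funUnique, Fin.default_eq_zero]
  rw [hset]
  exact (isSemialgebraic_setOf_eval_le _ _).inter (isSemialgebraic_setOf_eval_le _ _)

/-- Continuity of the elliptic integrand `s ↦ w / √p(s)` along a segment on which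
`p(s) = 4(x₀ + s v)³ − g₂(x₀ + s v) − g₃` stays in the slit plane. [folklore] -/
theorem continuousOn_div_sqrt_cubic {x₀ v g₂ g₃ w : ℂ} {S : Set ℝ}
    (hp : ∀ s ∈ S, 4 * (x₀ + (s : ℂ) * v) ^ 3 - g₂ * (x₀ + (s : ℂ) * v) - g₃ ∈ Complex.slitPlane) :
    ContinuousOn
      (fun s : ℝ => w / Complex.sqrt (4 * (x₀ + (s : ℂ) * v) ^ 3 - g₂ * (x₀ + (s : ℂ) * v) - g₃)) S := by
  intro s hs
  have h1 : ContinuousAt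
      (fun s : ℝ => 4 * (x₀ + (s : ℂ) * v) ^ 3 - g₂ * (x₀ + (s : ℂ) * v) - g₃) s := by
    fun_prop
  have h2 : ContinuousAt
      (fun s : ℝ => Complex.sqrt (4 * (x₀ + (s : ℂ) * v) ^ 3 - g₂ * (x₀ + (s : ℂ) * v) - g₃)) s :=
    ContinuousAt.comp (g := Complex.sqrt)
      (f := fun s : ℝ => 4 * (x₀ + (s : ℂ) * v) ^ 3 - g₂ * (x₀ + (s : ℂ) * v) - g₃) (x := s)
      (continuousAt_complexSqrt (hp s hs)) h1
  have h3 : ContinuousAt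
      (fun s : ℝ => w / Complex.sqrt (4 * (x₀ + (s : ℂ) * v) ^ 3 - g₂ * (x₀ + (s : ℂ) * v) - g₃)) s :=
    continuousAt_const.div h2 (complexSqrt_ne_zero (Complex.slitPlane_ne_zero (hp s hs)))
  exact h3.continuousWithinAt

/-- **One algebraic segment in the slit plane (real part).** For `x₀, v, g₂, g₃, w ∈ ℂ` with
algebraic real and imaginary parts and rationals `a ≤ b` such that
`p(s) = 4(x₀ + s v)³ − g₂(x₀ + s v) − g₃ ∈ ℂ ∖ (−∞, 0]` for `s ∈ [a, b]`, the real number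
`∫ₐᵇ re (w / √p(s)) ds` is a real Kontsevich–Zagier period: it is the absolutely convergent
integral over the `ℚ`-semialgebraic domain `[a, b] ⊆ ℝ¹` of a `ℚ`-semialgebraic (real-algebraic)
function, and algebraic integrands give the same periods as rational ones
(`KZ.isRealPeriod_iff_exists_integralRep_holds`). [Kontsevich–Zagier 2001, §1.1: elliptic
integrals; remark after the Definition] [cite: KontsevichZagier2001, §1.1] -/
theorem isRealPeriod_integral_re_div_sqrt {x₀ v g₂ g₃ w : ℂ}
    (hx₀ : IsAlgebraic ℚ x₀.re ∧ IsAlgebraic ℚ x₀.im) (hv : IsAlgebraic ℚ v.re ∧ IsAlgebraic ℚ v.im)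
    (hg₂ : IsAlgebraic ℚ g₂.re ∧ IsAlgebraic ℚ g₂.im) (hg₃ : IsAlgebraic ℚ g₃.re ∧ IsAlgebraic ℚ g₃.im)
    (hw : IsAlgebraic ℚ w.re ∧ IsAlgebraic ℚ w.im) {a b : ℚ} (hab : (a : ℝ) ≤ b)
    (hp : ∀ s ∈ Icc (a : ℝ) b,
      4 * (x₀ + (s : ℂ) * v) ^ 3 - g₂ * (x₀ + (s : ℂ) * v) - g₃ ∈ Complex.slitPlane) :
    IsRealPeriod (∫ s in (a : ℝ)..b,
      (w / Complex.sqrt (4 * (x₀ + (s : ℂ) * v) ^ 3 - g₂ * (x₀ + (s : ℂ) * v) - g₃)).re) := by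
  set F : ℝ → ℝ := fun s =>
    (w / Complex.sqrt (4 * (x₀ + (s : ℂ) * v) ^ 3 - g₂ * (x₀ + (s : ℂ) * v) - g₃)).re with hF
  have hmp : MeasurePreserving (MeasurableEquiv.funUnique (Fin 1) ℝ) volume volume :=
    MeasureTheory.volume_preserving_funUnique (Fin 1) ℝ
  set σ : Set (Fin 1 → ℝ) := (MeasurableEquiv.funUnique (Fin 1) ℝ) ⁻¹' Icc (a : ℝ) b with hσ
  have hσsa : IsSemialgebraic ℚ σ := isSemialgebraic_preimage_funUnique_Icc a b
  have hmemσ : ∀ u : Fin 1 → ℝ, u ∈ σ ↔ u 0 ∈ Icc (a : ℝ) b := fun u => Iff.rfl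
  -- continuity of the integrand on `[a, b]`
  have hFcont : ContinuousOn F (Icc (a : ℝ) b) :=
    Complex.continuous_re.comp_continuousOn (continuousOn_div_sqrt_cubic hp)
  -- the integrand is a `ℚ`-semialgebraic function on `σ`
  have hsa : IsSemialgebraicFunOn ℚ σ (fun u => F (u 0)) := by
    have hp' : ∀ u ∈ σ, 4 * (x₀ + (u 0 : ℂ) * v) ^ 3 - g₂ * (x₀ + (u 0 : ℂ) * v) - g₃ ≠ 0 :=
      fun u hu => Complex.slitPlane_ne_zero (hp (u 0) ((hmemσ u).1 hu))
    exact (re_im_ellipticIntegrand hσsa hx₀ hv hg₂ hg₃ hw hp').1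
  -- absolute convergence
  have hcompact : IsCompact σ :=
    (Homeomorph.funUnique (Fin 1) ℝ).isCompact_preimage.2 isCompact_Icc
  have hint : IntegrableOn (fun u => F (u 0)) σ :=
    (hFcont.comp (continuous_apply 0).continuousOn fun u hu => (hmemσ u).1 hu).integrableOn_compact
      hcompact
  -- the integral representation and its value
  let r : KZ.IntegralRep 1 := ⟨σ, fun u => F (u 0), hσsa, hsa, hint⟩
  have hval : r.value = ∫ s in (a : ℝ)..b, F s := by
    show ∫ u in σ, F (u 0) = _
    rw [intervalIntegral.integral_of_le hab, ← integral_Icc_eq_integral_Ioc]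
    exact hmp.setIntegral_preimage_emb (MeasurableEquiv.funUnique (Fin 1) ℝ).measurableEmbedding
      F (Icc (a : ℝ) b)
  exact KZ.isRealPeriod_iff_exists_integralRep_holds.mpr ⟨1, r, hval⟩

/-- **One algebraic segment in the slit plane.** Under the hypotheses of
`isRealPeriod_integral_re_div_sqrt`, `∫ₐᵇ w / √p(s) ds` is a Kontsevich–Zagier period (its
imaginary part is the real part of the same integral with `w` replaced by `−iw`).
[Kontsevich–Zagier 2001, §1.1] [cite: KontsevichZagier2001, §1.1] -/
theorem isPeriod_integral_div_sqrt {x₀ v g₂ g₃ w : ℂ}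
    (hx₀ : IsAlgebraic ℚ x₀.re ∧ IsAlgebraic ℚ x₀.im) (hv : IsAlgebraic ℚ v.re ∧ IsAlgebraic ℚ v.im)
    (hg₂ : IsAlgebraic ℚ g₂.re ∧ IsAlgebraic ℚ g₂.im) (hg₃ : IsAlgebraic ℚ g₃.re ∧ IsAlgebraic ℚ g₃.im)
    (hw : IsAlgebraic ℚ w.re ∧ IsAlgebraic ℚ w.im) {a b : ℚ} (hab : (a : ℝ) ≤ b)
    (hp : ∀ s ∈ Icc (a : ℝ) b,
      4 * (x₀ + (s : ℂ) * v) ^ 3 - g₂ * (x₀ + (s : ℂ) * v) - g₃ ∈ Complex.slitPlane) :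
    IsPeriod (∫ s in (a : ℝ)..b,
      w / Complex.sqrt (4 * (x₀ + (s : ℂ) * v) ^ 3 - g₂ * (x₀ + (s : ℂ) * v) - g₃)) := by
  have hint : ∀ w' : ℂ, IntervalIntegrable (fun s : ℝ =>
      w' / Complex.sqrt (4 * (x₀ + (s : ℂ) * v) ^ 3 - g₂ * (x₀ + (s : ℂ) * v) - g₃)) volume a b :=
    fun w' => (continuousOn_div_sqrt_cubic hp).intervalIntegrable_of_Icc hab
  constructor
  · rw [← Complex.reCLM_apply, ← ContinuousLinearMap.intervalIntegral_comp_comm _ (hint w)]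
    simpa using isRealPeriod_integral_re_div_sqrt hx₀ hv hg₂ hg₃ hw hab hp
  · have hI : (∫ s in (a : ℝ)..b,
        w / Complex.sqrt (4 * (x₀ + (s : ℂ) * v) ^ 3 - g₂ * (x₀ + (s : ℂ) * v) - g₃)).im =
        (∫ s in (a : ℝ)..b, (-Complex.I * w) /
          Complex.sqrt (4 * (x₀ + (s : ℂ) * v) ^ 3 - g₂ * (x₀ + (s : ℂ) * v) - g₃)).re := by
      have : (fun s : ℝ => (-Complex.I * w) /
          Complex.sqrt (4 * (x₀ + (s : ℂ) * v) ^ 3 - g₂ * (x₀ + (s : ℂ) * v) - g₃)) =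
          fun s : ℝ => (-Complex.I) *
            (w / Complex.sqrt (4 * (x₀ + (s : ℂ) * v) ^ 3 - g₂ * (x₀ + (s : ℂ) * v) - g₃)) := by
        funext s
        ring
      rw [this, intervalIntegral.integral_const_mul]
      simp
    rw [hI, ← Complex.reCLM_apply, ← ContinuousLinearMap.intervalIntegral_comp_comm _ (hint _)]
    have hw' : IsAlgebraic ℚ (-Complex.I * w).re ∧ IsAlgebraic ℚ (-Complex.I * w).im :=
      ⟨by simpa using hw.2, by simpa using hw.1.neg⟩
    simpa using isRealPeriod_integral_re_div_sqrt hx₀ hv hg₂ hg₃ hw' hab hp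

/-! ### A continuous branch of `y` on `[0, 1]` -/

/-- **Elliptic integrals over algebraic segments are periods.** Let `x₀, v, g₂, g₃ ∈ ℂ` have
algebraic real and imaginary parts and let `y : [0, 1] → ℂ` be continuous with `y(s) ≠ 0` and
`y(s)² = 4(x₀ + s v)³ − g₂(x₀ + s v) − g₃` (a continuous branch of `y` on the curve
`y² = 4x³ − g₂x − g₃` over the segment `x = x₀ + s v`). Then `∫₀¹ v ds / y(s)` — the integral of
`dx/y` along that path — is a Kontsevich–Zagier period. The interval is cut at rational points
into finitely many pieces on which `p` or `−p` avoids `(−∞, 0]`; there `y = ±√p` or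
`y = ±i√(−p)` and `isPeriod_integral_div_sqrt` applies (to `p`, or to `−p` written as the cubic
attached to `−x₀, −v, g₂, −g₃`); the pieces are added with `isPeriod_sum`.
[Kontsevich–Zagier 2001, §1.1 (elliptic integrals)] [cite: KontsevichZagier2001, §1.1] -/
theorem isPeriod_integral_div_of_sq_eq_cubic {x₀ v g₂ g₃ : ℂ}
    (hx₀ : IsAlgebraic ℚ x₀.re ∧ IsAlgebraic ℚ x₀.im) (hv : IsAlgebraic ℚ v.re ∧ IsAlgebraic ℚ v.im)
    (hg₂ : IsAlgebraic ℚ g₂.re ∧ IsAlgebraic ℚ g₂.im) (hg₃ : IsAlgebraic ℚ g₃.re ∧ IsAlgebraic ℚ g₃.im)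
    {y : ℝ → ℂ} (hyc : ContinuousOn y (Icc 0 1))
    (hy : ∀ s ∈ Icc (0 : ℝ) 1, y s ≠ 0 ∧
      y s ^ 2 = 4 * (x₀ + (s : ℂ) * v) ^ 3 - g₂ * (x₀ + (s : ℂ) * v) - g₃) :
    IsPeriod (∫ s in (0 : ℝ)..1, v / y s) := by
  set p : ℝ → ℂ := fun s => 4 * (x₀ + (s : ℂ) * v) ^ 3 - g₂ * (x₀ + (s : ℂ) * v) - g₃ with hpdef
  have hpcont : Continuous p := by
    simp only [hpdef]
    fun_prop
  have hp0 : ∀ s ∈ Icc (0 : ℝ) 1, p s ≠ 0 := fun s hs h =>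
    (hy s hs).1 (pow_eq_zero_iff two_ne_zero |>.mp (((hy s hs).2).trans h))
  -- `(√z)² = z` (the tree's `Literature.NumberTheory.EllipticCurves.ModularForms.csqrt_sq`,
  -- restated locally to keep the modular-forms files out of the import closure)
  have hsqrt_sq : ∀ z : ℂ, Complex.sqrt z ^ 2 = z := fun z => Complex.cpow_ofNat_inv_pow z 2
  -- a Lebesgue number for the cover of `[0, 1]` by `{p ∈ slit}` and `{-p ∈ slit}`
  obtain ⟨δ, hδ, hleb⟩ : ∃ δ > 0, ∀ s ∈ Icc (0 : ℝ) 1,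
      ball s δ ⊆ {t | p t ∈ Complex.slitPlane} ∨ ball s δ ⊆ {t | -p t ∈ Complex.slitPlane} := by
    set U : Bool → Set ℝ := fun b =>
      if b then {t | p t ∈ Complex.slitPlane} else {t | -p t ∈ Complex.slitPlane} with hU
    have hopen : ∀ b, IsOpen (U b) := by
      intro b
      cases b
      · simp only [hU, Bool.false_eq_true, ↓reduceIte]
        exact Complex.isOpen_slitPlane.preimage hpcont.neg
      · simp only [hU, ↓reduceIte]
        exact Complex.isOpen_slitPlane.preimage hpcont
    have hcover : Icc (0 : ℝ) 1 ⊆ ⋃ b, U b := by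
      intro s hs
      by_cases h : p s ∈ Complex.slitPlane
      · exact mem_iUnion.2 ⟨true, by simpa [hU] using h⟩
      · refine mem_iUnion.2 ⟨false, ?_⟩
        simp only [hU, Bool.false_eq_true, ↓reduceIte, mem_setOf_eq]
        rw [Complex.mem_slitPlane_iff, not_or, not_lt, not_ne_iff] at h
        rw [Complex.mem_slitPlane_iff]
        left
        rcases h.1.lt_or_eq with hlt | heq
        · simpa using hlt
        · exact absurd (Complex.ext heq h.2) (hp0 s hs)
    obtain ⟨δ, hδ, h⟩ := lebesgue_number_lemma_of_metric isCompact_Icc hopen hcover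
    refine ⟨δ, hδ, fun s hs => ?_⟩
    obtain ⟨b, hb⟩ := h s hs
    cases b
    · exact Or.inr (by simpa [hU] using hb)
    · exact Or.inl (by simpa [hU] using hb)
  -- the rational mesh `a j = j / M`, `1 / M < δ`
  obtain ⟨M, hM⟩ : ∃ M : ℕ, 1 / δ < M := exists_nat_gt _
  have hMreal : (0 : ℝ) < M := lt_of_le_of_lt (by positivity) hM
  have hMpos : 0 < M := by exact_mod_cast hMreal
  have hmesh : 1 / (M : ℝ) < δ := by
    rw [div_lt_iff₀ hMreal]
    have := (div_lt_iff₀ hδ).mp hM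
    linarith
  set a : ℕ → ℚ := fun j => (j : ℚ) / M with ha
  have hacast : ∀ j : ℕ, ((a j : ℚ) : ℝ) = (j : ℝ) / M := fun j => by
    simp only [ha]
    push_cast
    ring
  have ha0 : ((a 0 : ℚ) : ℝ) = 0 := by simp [hacast]
  have haM : ((a M : ℚ) : ℝ) = 1 := by
    rw [hacast, div_self hMreal.ne']
  have hale : ∀ j : ℕ, ((a j : ℚ) : ℝ) ≤ a (j + 1) := fun j => by
    rw [hacast, hacast]
    refine div_le_div_of_nonneg_right ?_ hMreal.le
    push_cast
    linarith
  have hadiff : ∀ j : ℕ, ((a (j + 1) : ℚ) : ℝ) - a j = 1 / M := fun j => by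
    rw [hacast, hacast]
    push_cast
    ring
  have hpiece : ∀ j < M, Icc ((a j : ℚ) : ℝ) (a (j + 1)) ⊆ Icc 0 1 ∧
      ((∀ t ∈ Icc ((a j : ℚ) : ℝ) (a (j + 1)), p t ∈ Complex.slitPlane) ∨
        (∀ t ∈ Icc ((a j : ℚ) : ℝ) (a (j + 1)), -p t ∈ Complex.slitPlane)) := by
    intro j hj
    have hj0 : (0 : ℝ) ≤ a j := by rw [hacast]; positivity
    have hj1 : ((a (j + 1) : ℚ) : ℝ) ≤ 1 := by
      rw [hacast]
      refine div_le_one_of_le₀ ?_ hMreal.le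
      exact_mod_cast hj
    have hsub1 : Icc ((a j : ℚ) : ℝ) (a (j + 1)) ⊆ Icc 0 1 :=
      Icc_subset_Icc hj0 hj1
    have haj : ((a j : ℚ) : ℝ) ∈ Icc (0 : ℝ) 1 := ⟨hj0, (hale j).trans hj1⟩
    have hsub2 : Icc ((a j : ℚ) : ℝ) (a (j + 1)) ⊆ ball ((a j : ℚ) : ℝ) δ := fun t ht => by
      rw [mem_ball, Real.dist_eq, abs_lt]
      have := hadiff j
      constructor <;> linarith [ht.1, ht.2]
    rcases hleb _ haj with h | h
    · exact ⟨hsub1, Or.inl fun t ht => h (hsub2 ht)⟩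
    · exact ⟨hsub1, Or.inr fun t ht => h (hsub2 ht)⟩
  -- each piece is a period
  have hper : ∀ j < M, IsPeriod (∫ s in ((a j : ℚ) : ℝ)..(a (j + 1)), v / y s) := by
    intro j hj
    obtain ⟨hsub, hcase⟩ := hpiece j hj
    have hyc' : ContinuousOn y (Icc ((a j : ℚ) : ℝ) (a (j + 1))) := hyc.mono hsub
    have hconn : IsPreconnected (Icc ((a j : ℚ) : ℝ) (a (j + 1))) := isPreconnected_Icc
    rcases hcase with hslit | hslit
    · -- `p` stays in the slit plane: `y = ± √p`
      have hgc : ContinuousOn (fun t => Complex.sqrt (p t)) (Icc ((a j : ℚ) : ℝ) (a (j + 1))) :=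
        fun t ht => ((continuousAt_complexSqrt (hslit t ht)).comp
          hpcont.continuousAt).continuousWithinAt
      have hg0 : ∀ {t}, t ∈ Icc ((a j : ℚ) : ℝ) (a (j + 1)) → Complex.sqrt (p t) ≠ 0 :=
        fun ht => complexSqrt_ne_zero (Complex.slitPlane_ne_zero (hslit _ ht))
      have hsq : EqOn (y ^ 2) ((fun t => Complex.sqrt (p t)) ^ 2) (Icc ((a j : ℚ) : ℝ) (a (j + 1))) :=
        fun t ht => by
          simp only [Pi.pow_apply, hsqrt_sq]
          exact (hy t (hsub ht)).2
      rcases hconn.eq_or_eq_neg_of_sq_eq hyc' hgc hsq hg0 with heq | heq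
      · have : ∫ s in ((a j : ℚ) : ℝ)..(a (j + 1)), v / y s =
            ∫ s in ((a j : ℚ) : ℝ)..(a (j + 1)), v / Complex.sqrt (p s) :=
          intervalIntegral.integral_congr fun s hs => by
            rw [uIcc_of_le (hale j)] at hs
            simp only [heq hs]
        rw [this]
        exact isPeriod_integral_div_sqrt hx₀ hv hg₂ hg₃ hv (hale j) hslit
      · have : ∫ s in ((a j : ℚ) : ℝ)..(a (j + 1)), v / y s =
            ∫ s in ((a j : ℚ) : ℝ)..(a (j + 1)), (-v) / Complex.sqrt (p s) :=
          intervalIntegral.integral_congr fun s hs => by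
            rw [uIcc_of_le (hale j)] at hs
            simp only [heq hs, Pi.neg_apply]
            ring
        rw [this]
        exact isPeriod_integral_div_sqrt hx₀ hv hg₂ hg₃ (isAlgebraic_re_im_neg hv) (hale j) hslit
    · -- `-p` stays in the slit plane: `y = ± i √(-p)`, and `-p` is the cubic of `-x₀, -v, g₂, -g₃`
      have hnegp : ∀ t : ℝ, -p t =
          4 * (-x₀ + (t : ℂ) * (-v)) ^ 3 - g₂ * (-x₀ + (t : ℂ) * (-v)) - (-g₃) := fun t => by
        simp only [hpdef]
        ring
      have hslit' : ∀ t ∈ Icc ((a j : ℚ) : ℝ) (a (j + 1)),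
          4 * (-x₀ + (t : ℂ) * (-v)) ^ 3 - g₂ * (-x₀ + (t : ℂ) * (-v)) - (-g₃) ∈
            Complex.slitPlane := fun t ht => hnegp t ▸ hslit t ht
      have hgc : ContinuousOn (fun t => Complex.I * Complex.sqrt (-p t))
          (Icc ((a j : ℚ) : ℝ) (a (j + 1))) :=
        fun t ht => (continuousAt_const.mul (ContinuousAt.comp (g := Complex.sqrt)
          (f := fun t : ℝ => -p t) (x := t) (continuousAt_complexSqrt (hslit t ht))
          hpcont.neg.continuousAt)).continuousWithinAt
      have hg0 : ∀ {t}, t ∈ Icc ((a j : ℚ) : ℝ) (a (j + 1)) →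
          Complex.I * Complex.sqrt (-p t) ≠ 0 :=
        fun ht => mul_ne_zero Complex.I_ne_zero
          (complexSqrt_ne_zero (Complex.slitPlane_ne_zero (hslit _ ht)))
      have hsq : EqOn (y ^ 2) ((fun t => Complex.I * Complex.sqrt (-p t)) ^ 2)
          (Icc ((a j : ℚ) : ℝ) (a (j + 1))) := fun t ht => by
        simp only [Pi.pow_apply, mul_pow, hsqrt_sq, Complex.I_sq]
        rw [(hy t (hsub ht)).2]
        ring
      rcases hconn.eq_or_eq_neg_of_sq_eq hyc' hgc hsq hg0 with heq | heq
      · have : ∫ s in ((a j : ℚ) : ℝ)..(a (j + 1)), v / y s =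
            ∫ s in ((a j : ℚ) : ℝ)..(a (j + 1)), (-(Complex.I * v)) /
              Complex.sqrt (4 * (-x₀ + (s : ℂ) * (-v)) ^ 3 - g₂ * (-x₀ + (s : ℂ) * (-v)) - (-g₃)) :=
          intervalIntegral.integral_congr fun s hs => by
            rw [uIcc_of_le (hale j)] at hs
            simp only [heq hs, ← hnegp]
            rw [mul_comm Complex.I, ← div_div, div_eq_mul_inv _ Complex.I, Complex.inv_I]
            ring
        rw [this]
        exact isPeriod_integral_div_sqrt (isAlgebraic_re_im_neg hx₀) (isAlgebraic_re_im_neg hv)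
          hg₂ (isAlgebraic_re_im_neg hg₃) (isAlgebraic_re_im_neg (isAlgebraic_re_im_I_mul hv))
          (hale j) hslit'
      · have : ∫ s in ((a j : ℚ) : ℝ)..(a (j + 1)), v / y s =
            ∫ s in ((a j : ℚ) : ℝ)..(a (j + 1)), (Complex.I * v) /
              Complex.sqrt (4 * (-x₀ + (s : ℂ) * (-v)) ^ 3 - g₂ * (-x₀ + (s : ℂ) * (-v)) - (-g₃)) :=
          intervalIntegral.integral_congr fun s hs => by
            rw [uIcc_of_le (hale j)] at hs
            simp only [heq hs, Pi.neg_apply, ← hnegp]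
            rw [div_neg, mul_comm Complex.I, ← div_div, div_eq_mul_inv _ Complex.I, Complex.inv_I]
            ring
        rw [this]
        exact isPeriod_integral_div_sqrt (isAlgebraic_re_im_neg hx₀) (isAlgebraic_re_im_neg hv)
          hg₂ (isAlgebraic_re_im_neg hg₃) (isAlgebraic_re_im_I_mul hv) (hale j) hslit'
  -- add the pieces
  have hsum : ∫ s in (0 : ℝ)..1, v / y s =
      ∑ j ∈ Finset.range M, ∫ s in ((a j : ℚ) : ℝ)..(a (j + 1)), v / y s := by
    rw [intervalIntegral.sum_integral_adjacent_intervals, ha0, haM]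
    intro k hk
    refine ContinuousOn.intervalIntegrable_of_Icc (hale k) ?_
    exact continuousOn_const.div (hyc.mono (hpiece k hk).1)
      fun t ht => (hy t ((hpiece k hk).1 ht)).1
  rw [hsum]
  exact isPeriod_sum _ _ fun j hj => hper j (Finset.mem_range.mp hj)

end Literature.NumberTheory.Transcendental
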